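import Summits.ABC.StewartYu.PadicG3TwoHeadline
import HarnessLib

/-!
# Cell abc-stewartyu, crux `Y07Odd` (stmt-ABC-19658): the HEADLINE of the v1 ledger for ODD `p`, branch `m ≥ 1` —
# `8·2ⁿ·(G·X·L)` is below `2^{100·n}·p·Ω·W⁺` (indeed with a spare factor `2`, and also below `2^{100n}·(p/log p)·Ω·W⁺`)

`Summits/ABC/StewartYu/PadicG3OddHeadline1.lean` — cell `abc-stewartyu` (HOME `run/shared/lean/pub/abc-stewartyu/`),
route `PadicPrimesKummerThird`, crux `Y07Odd` (stmt-ABC-19658); seat lp-1 (g3), planner g9's assignment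
2026-08-27T04:58:45Z/04:59:21Z («unowned piece: the v1 headline», cell constant `cY07 = 2^100` since 05:05:21Z).
Theorems only — the odd-`p`, `m ≥ 1` twin of p3's `headline_two` (`PadicG3TwoHeadline`, p495518), on the v1
parameter ledger `P : PadicG3Par n` with `θ₀ = ½`, `N_q = K` (R21-b), `Amax ≤ 2ⁿΩ`, `Aⱼ ≥ 1`, `n ≥ 2`.

When the class device is active (`1 ≤ m`), `½·log p < 8(n+1)` (`θ₀_log_lt_of_m_pos`), so `p < e^{16(n+1)} ≤ 2^{24(n+1)}`
— the «p-excess at the threshold» is a constant to the power `n`.  Chain (all crude; margin ≥ 3.7e12 per factor,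
HOME/plan/m3/const/c1_mge1_check.out): `G ≤ 32(n+1)`; `K ≤ K₀·p·e^{8(n+1)} ≤ p·2^{36(n+1)}`; `L ≤ (264C_bⁿ + 2^{2n+26})·K·Ω
≤ 2^{63}·2^{43n}·p·Ω` (`L_le_KΩ`); `log L ≤ 0.7(43n+63) + log p + n·log(2Amax)`; `W_L ≤ 2.2 + W + log L`;
`X ≤ 2^{27}·(n+1)·W⁺`; hence `16·2ⁿ·G·X·L ≤ 2^{46n+99}·p·Ω·W⁺ ≤ 2^{100n}·p·Ω·W⁺` for `n ≥ 2` — the `hU` of the v1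
master `PadicG3Par.order_budget` (ParE) at `U := 2^{100n}·p·Ω·W⁺/2` (`headline_odd1`), resp. with `p/log p`
(`headline_odd1_div_log`, using `log p < 16(n+1) ≤ 2^{n+3}`).

References: Yu. V. Nesterenko, LNM 1819 (2003), §3.5 (3.23), Prop 3.9; K. Yu, Acta Arith. 89 (1999), (10.16).
-/

noncomputable section

open Finset Real

namespace Summit.ABC.StewartYu

namespace PadicG3Par

variable {n : ℕ} (P : PadicG3Par n)

/-! ### The threshold regime `m ≥ 1`: `p` is bounded in terms of `n` -/

/-- `1 ≤ m`, `θ₀ = ½` ⟹ `log p < 16(n+1)`. [folklore] -/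
theorem log_p_lt_of_m_pos (hm : 1 ≤ P.m) (hθ : P.θ₀ = 1 / 2) : Real.log P.p < 16 * ((n : ℝ) + 1) := by
  have h := P.θ₀_log_lt_of_m_pos hm
  rw [hθ] at h; unfold cG at h
  linarith

/-- `1 ≤ m`, `θ₀ = ½` ⟹ `G ≤ 32(n+1)` (`G ≤ 8(n+1) + (3/2)·log p`). [folklore] -/
theorem G_le_of_m_pos (hm : 1 ≤ P.m) (hθ : P.θ₀ = 1 / 2) : P.G ≤ 32 * ((n : ℝ) + 1) := by
  have h1 := P.G_le
  have h2 := P.log_p_lt_of_m_pos hm hθ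
  rw [hθ] at h1; unfold cG at h1
  have hlog := P.log_p_pos
  linarith

/-- `1 ≤ m`, `θ₀ = ½` ⟹ `p ≤ 2^{24(n+1)}` (`p = e^{log p} < e^{16(n+1)}`, `e⁸ ≤ 2^{12}`). [folklore] -/
theorem p_le_two_pow_of_m_pos (hm : 1 ≤ P.m) (hθ : P.θ₀ = 1 / 2) : (P.p : ℝ) ≤ (2 : ℝ) ^ (24 * (n + 1)) := by
  have h1 := P.log_p_lt_of_m_pos hm hθ
  have hp : (0 : ℝ) < P.p := by linarith [P.two_le_p]
  have h2 : (P.p : ℝ) = Real.exp (Real.log P.p) := (Real.exp_log hp).symm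
  have h3 : Real.exp (Real.log P.p) ≤ Real.exp (8 * ((2 * (n + 1) : ℕ) : ℝ)) :=
    Real.exp_le_exp.mpr (by push_cast; linarith)
  have h4 := exp_eight_mul_le (2 * (n + 1))
  rw [h2]
  calc Real.exp (Real.log P.p) ≤ Real.exp (8 * ((2 * (n + 1) : ℕ) : ℝ)) := h3
    _ ≤ (2 : ℝ) ^ (12 * (2 * (n + 1))) := h4
    _ = (2 : ℝ) ^ (24 * (n + 1)) := by ring_nf

/-- `1 ≤ m`, `θ₀ = ½` ⟹ **`K ≤ p·2^{36(n+1)}`** (`K ≤ K₀·p·e^{8(n+1)}`, `K₀ ≤ p ≤ 2^{24(n+1)}`, `e^{8(n+1)} ≤ 2^{12(n+1)}`).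
[cite: Yu1999, (10.16); shape only] -/
theorem K_le_of_m_pos (hm : 1 ≤ P.m) (hθ : P.θ₀ = 1 / 2) : (P.K : ℝ) ≤ P.p * (2 : ℝ) ^ (36 * (n + 1)) := by
  have h := P.K_le
  unfold cG at h
  have hK₀ : (P.K₀ : ℝ) ≤ P.p := by exact_mod_cast P.hK₀p
  have hp := P.p_le_two_pow_of_m_pos hm hθ
  have he := exp_eight_mul_le (n + 1)
  push_cast at he
  have hp0 : (0 : ℝ) ≤ P.p := by positivity
  have hexp0 : 0 ≤ Real.exp (8 * ((n : ℝ) + 1)) := (Real.exp_pos _).le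
  have e : (2 : ℝ) ^ (36 * (n + 1)) = 2 ^ (24 * (n + 1)) * 2 ^ (12 * (n + 1)) := by
    rw [← pow_add]; ring_nf
  rw [e]
  calc (P.K : ℝ) ≤ P.K₀ * (P.p * Real.exp (8 * (n + 1))) := h
    _ ≤ P.p * (P.p * Real.exp (8 * (n + 1))) := mul_le_mul_of_nonneg_right hK₀ (by positivity)
    _ ≤ P.p * ((2 : ℝ) ^ (24 * (n + 1)) * 2 ^ (12 * (n + 1))) := by
        apply mul_le_mul_of_nonneg_left _ hp0
        exact mul_le_mul hp he hexp0 (by positivity)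

/-- `1 ≤ m`, `θ₀ = ½` ⟹ **`L ≤ 2^{63}·(2ⁿ)^{43}·p·Ω`** under the instantiation facts. [cite: Nesterenko2003, §3.5 (3.23); shape only] -/
theorem L_le_of_m_pos (hm : 1 ≤ P.m) (hθ : P.θ₀ = 1 / 2) (hNqK : P.Nq ≤ 2 ^ n * P.K)
    (hAmax : P.Amax ≤ 2 ^ n * P.Ω) (hA1 : ∀ j, 1 ≤ P.A j) :
    (P.L : ℝ) ≤ (2 : ℝ) ^ 63 * ((2 : ℝ) ^ n) ^ 43 * P.p * P.Ω := by
  have hL := P.L_le_KΩ (by rw [hθ]) hNqK hAmax hA1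
  have hK := P.K_le_of_m_pos hm hθ
  have hCb := Cb_le
  have hCb0 : (0 : ℝ) ≤ Cb := le_trans (by norm_num) sixtyfour_le_Cb
  have hΩ := P.Ω_pos
  have hp0 : (0 : ℝ) ≤ P.p := by positivity
  obtain ⟨E, hE⟩ : ∃ E : ℝ, E = (2 : ℝ) ^ n := ⟨_, rfl⟩
  have hE1 : 1 ≤ E := by rw [hE]; exact one_le_pow₀ (by norm_num)
  have hE0 : 0 ≤ E := by linarith
  -- `Cbⁿ ≤ 128ⁿ = E^7`, `2^{2n+26} = 2^26·E^2`, `2^{36(n+1)} = 2^{36}·E^{36}`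
  have hCbn : Cb ^ n ≤ E ^ 7 := by
    calc Cb ^ n ≤ (128 : ℝ) ^ n := pow_le_pow_left₀ hCb0 (by linarith) n
      _ = E ^ 7 := by rw [hE, ← pow_mul, show (128:ℝ) = 2^7 by norm_num, ← pow_mul, mul_comm]
  have h26 : (2 : ℝ) ^ (2 * n + 26) = 2 ^ 26 * E ^ 2 := by
    rw [hE, ← pow_mul, pow_add, mul_comm n 2, pow_mul]; ring
  have h36 : (2 : ℝ) ^ (36 * (n + 1)) = 2 ^ 36 * E ^ 36 := by
    rw [hE, ← pow_mul, show 36 * (n + 1) = 36 + n * 36 by ring, pow_add]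
  have hcoef : 264 * Cb ^ n + (2 : ℝ) ^ (2 * n + 26) ≤ 2 ^ 27 * E ^ 7 := by
    rw [h26]
    have hE2 : E ^ 2 ≤ E ^ 7 := pow_le_pow_right₀ hE1 (by norm_num)
    nlinarith [pow_nonneg hE0 7]
  rw [h36] at hK
  have hKΩ : 0 ≤ (P.K : ℝ) * P.Ω := by have := P.K_pos; positivity
  calc (P.L : ℝ) ≤ (264 * Cb ^ n + 2 ^ (2 * n + 26)) * P.K * P.Ω := hL
    _ ≤ (2 ^ 27 * E ^ 7) * (P.p * (2 ^ 36 * E ^ 36)) * P.Ω := by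
        rw [mul_assoc, mul_assoc]
        exact mul_le_mul hcoef (mul_le_mul_of_nonneg_right hK hΩ.le) hKΩ (by positivity)
    _ = (2 : ℝ) ^ 63 * ((2 : ℝ) ^ n) ^ 43 * P.p * P.Ω := by rw [hE]; ring

/-- `1 ≤ m`, `θ₀ = ½` ⟹ **`log L ≤ (43n+63)·(7/10) + log p + n·log(2·Amax)`**. [folklore] -/
theorem log_L_le_of_m_pos (hm : 1 ≤ P.m) (hθ : P.θ₀ = 1 / 2) (hNqK : P.Nq ≤ 2 ^ n * P.K)
    (hAmax : P.Amax ≤ 2 ^ n * P.Ω) (hA1 : ∀ j, 1 ≤ P.A j) :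
    Real.log P.L ≤ (43 * (n : ℝ) + 63) * (7 / 10) + Real.log P.p + n * Real.log (2 * P.Amax) := by
  have hL := P.L_le_of_m_pos hm hθ hNqK hAmax hA1
  have hL1 := P.one_le_L
  have hΩ := P.Ω_pos
  have hA1' := P.hAmax1
  have hp : (0 : ℝ) < P.p := by linarith [P.two_le_p]
  have h := Real.log_le_log (by linarith) hL
  -- the logarithm of the bound
  have e1 : Real.log ((2 : ℝ) ^ 63 * ((2 : ℝ) ^ n) ^ 43 * P.p * P.Ω) =
      63 * Real.log 2 + 43 * n * Real.log 2 + Real.log P.p + Real.log P.Ω := by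
    rw [Real.log_mul (by positivity) hΩ.ne', Real.log_mul (by positivity) hp.ne',
      Real.log_mul (by positivity) (by positivity), ← pow_mul, Real.log_pow, Real.log_pow]
    push_cast; ring
  rw [e1] at h
  have hΩle : Real.log P.Ω ≤ n * Real.log (2 * P.Amax) := by
    have h1 := Real.log_le_log hΩ P.Ω_le_pow
    rw [Real.log_pow] at h1
    have h2 : Real.log P.Amax ≤ Real.log (2 * P.Amax) := Real.log_le_log (by linarith) (by linarith)
    have hn0 : (0 : ℝ) ≤ n := by positivity
    have h3 := mul_le_mul_of_nonneg_left h2 hn0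
    linarith
  obtain ⟨_, hl2, _⟩ := log_consts
  have hn0 : (0 : ℝ) ≤ 43 * (n : ℝ) + 63 := by positivity
  have h4 : (43 * (n : ℝ) + 63) * Real.log 2 ≤ (43 * (n : ℝ) + 63) * (7 / 10) :=
    mul_le_mul_of_nonneg_left hl2 hn0
  linarith

/-- `W + log p + n·log(2Amax) ≤ n·W⁺` (`n ≥ 1`). [folklore] -/
theorem W_add_log_le_mul_Wp : P.W + Real.log P.p + n * Real.log (2 * P.Amax) ≤ n * P.Wp := by
  unfold Wp
  have hn : (1 : ℝ) ≤ n := by exact_mod_cast P.hn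
  have hW := P.hW
  have hlog := P.log_p_pos
  have h := mul_nonneg (by linarith : (0 : ℝ) ≤ n - 1) (by linarith : (0 : ℝ) ≤ P.W + Real.log P.p)
  nlinarith [h]

/-- `1 ≤ m`, `θ₀ = ½` ⟹ **`X ≤ 2^{27}·(n+1)·W⁺`**. [cite: Nesterenko2003, Prop 3.9; shape only] -/
theorem X_le_of_m_pos (hm : 1 ≤ P.m) (hθ : P.θ₀ = 1 / 2) (hNqK : P.Nq ≤ 2 ^ n * P.K)
    (hAmax : P.Amax ≤ 2 ^ n * P.Ω) (hA1 : ∀ j, 1 ≤ P.A j) :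
    (P.X : ℝ) ≤ (2 : ℝ) ^ 27 * ((n : ℝ) + 1) * P.Wp := by
  have hWL := P.WL_le_log
  have hlogL := P.log_L_le_of_m_pos hm hθ hNqK hAmax hA1
  have hLKΩ := P.L_le_KΩ (by rw [hθ]) hNqK hAmax hA1
  have hWsum := P.W_add_log_le_mul_Wp
  have hG8 : 8 * ((n : ℝ) + 1) ≤ P.G := by have := P.n_le; linarith
  have hGpos : 0 < P.G := by linarith [P.eight_le_G]
  have hWp1 := P.one_le_Wp
  have hWL0 : 0 ≤ P.WL := le_trans zero_le_one P.WL_ge_one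
  have hn0 : (0 : ℝ) ≤ n := by positivity
  -- the two branches of `X`
  obtain ⟨a, ha⟩ : ∃ a : ℝ, a = 64 * (n + 1) * P.WL / P.G := ⟨_, rfl⟩
  obtain ⟨b, hb⟩ : ∃ b : ℝ, b = (3 / 2) * (n + 1) * P.L / (Cb ^ n * P.Ω * P.K) := ⟨_, rfl⟩
  have ha0 : 0 ≤ a := by rw [ha]; positivity
  have hcore := P.core_pos
  have hCb64 : (64 : ℝ) ≤ Cb := sixtyfour_le_Cb
  have hb0 : 0 ≤ b := by rw [hb]; have := P.one_le_L; positivity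
  have hX : (P.X : ℝ) ≤ a + b + 2 := by
    have h1 : P.X ≤ ⌈a⌉₊ + ⌈b⌉₊ := by
      unfold X; rw [ha, hb]; exact max_le (Nat.le_add_right _ _) (Nat.le_add_left _ _)
    have h2 : (P.X : ℝ) ≤ (⌈a⌉₊ : ℝ) + (⌈b⌉₊ : ℝ) := by exact_mod_cast h1
    have h3 := (Nat.ceil_lt_add_one ha0).le
    have h4 := (Nat.ceil_lt_add_one hb0).le
    linarith
  -- `a ≤ 8·WL`
  have ha' : a ≤ 8 * P.WL := by
    rw [ha, div_le_iff₀ hGpos]; nlinarith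
  -- `b ≤ (3/2)(n+1)(264 + 2^26)`
  have hb' : b ≤ (3 / 2) * ((n : ℝ) + 1) * (264 + 2 ^ 26) := by
    rw [hb, div_le_iff₀ hcore]
    have hCbn : (4 : ℝ) ^ n ≤ Cb ^ n := pow_le_pow_left₀ (by norm_num) (by linarith) n
    have h2n : (2 : ℝ) ^ (2 * n + 26) = 2 ^ 26 * (4 : ℝ) ^ n := by
      rw [pow_add, pow_mul]; norm_num; ring
    have hKΩ : (1 : ℝ) ≤ P.K * P.Ω := by
      have hK1 : (1 : ℝ) ≤ P.K := by exact_mod_cast P.one_le_K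
      have hΩ1 : (1 : ℝ) ≤ P.Ω := by
        unfold Ω
        calc (1 : ℝ) = ∏ _j : Fin n, (1 : ℝ) := by simp
          _ ≤ ∏ j, P.A j := Finset.prod_le_prod (fun _ _ => zero_le_one) fun j _ => hA1 j
      nlinarith
    have hKΩ0 : (0 : ℝ) ≤ P.K * P.Ω := by linarith
    calc (3 / 2) * ((n : ℝ) + 1) * P.L ≤ (3 / 2) * ((n : ℝ) + 1) * ((264 * Cb ^ n + 2 ^ (2 * n + 26)) * P.K * P.Ω) := by
          nlinarith
      _ ≤ (3 / 2) * ((n : ℝ) + 1) * (264 + 2 ^ 26) * (Cb ^ n * P.Ω * P.K) := by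
          rw [h2n]
          have hc : (264 * Cb ^ n + 2 ^ 26 * (4 : ℝ) ^ n) ≤ (264 + 2 ^ 26) * Cb ^ n := by nlinarith
          have := mul_le_mul_of_nonneg_right hc hKΩ0
          nlinarith
  -- assemble (linear in the atoms `n`, `n·W⁺`, `W⁺`)
  have hstep : (P.X : ℝ) ≤ 8 * (11 / 5 + (43 * (n : ℝ) + 63) * (7 / 10)) + 8 * (n * P.Wp) +
      (3 / 2) * ((n : ℝ) + 1) * (264 + 2 ^ 26) + 2 := by linarith
  have hnW : (n : ℝ) ≤ n * P.Wp := le_mul_of_one_le_right hn0 hWp1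
  have e27 : (2 : ℝ) ^ 27 * ((n : ℝ) + 1) * P.Wp = 2 ^ 27 * (n * P.Wp) + 2 ^ 27 * P.Wp := by ring
  rw [e27]
  have h27 : (2 : ℝ) ^ 27 = 134217728 := by norm_num
  have h26 : (2 : ℝ) ^ 26 = 67108864 := by norm_num
  rw [h27]; rw [h26] at hstep
  linarith


/-! ### The headline -/

/-- **THE HEADLINE OF THE v1 LEDGER, odd `p`, `m ≥ 1`**: `2·(8·2ⁿ·(G·X·L)) ≤ 2^{100·n}·p·Ω·W⁺` (`n ≥ 2`,
`θ₀ = ½`, `N_q = K`, `Amax ≤ 2ⁿΩ`, `Aⱼ ≥ 1`) — the `hU` of `PadicG3Par.order_budget` with a spare factor `2` for the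
glue's additive losses. [cite: Yu2007, Main Thm (K = ℚ); shape only] -/
theorem headline_odd1 (hn : 2 ≤ n) (hm : 1 ≤ P.m) (hθ : P.θ₀ = 1 / 2) (hNq : P.Nq = P.K)
    (hAmax : P.Amax ≤ 2 ^ n * P.Ω) (hA1 : ∀ j, 1 ≤ P.A j) :
    2 * (8 * 2 ^ n * (P.G * P.X * P.L)) ≤ (2 : ℝ) ^ (100 * n) * P.p * P.Ω * P.Wp := by
  have hNqK : P.Nq ≤ 2 ^ n * P.K := by rw [hNq]; exact Nat.le_mul_of_pos_left _ (Nat.two_pow_pos n)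
  have hG := P.G_le_of_m_pos hm hθ
  have hL := P.L_le_of_m_pos hm hθ hNqK hAmax hA1
  have hX := P.X_le_of_m_pos hm hθ hNqK hAmax hA1
  have hΩ := P.Ω_pos
  have hWp := P.one_le_Wp
  have hp0 : (0 : ℝ) ≤ P.p := by positivity
  have hG0 : (0 : ℝ) ≤ P.G := by linarith [P.eight_le_G]
  have hX0 : (0 : ℝ) ≤ P.X := by positivity
  have hL0 : (0 : ℝ) ≤ P.L := by positivity
  obtain ⟨E, hE⟩ : ∃ E : ℝ, E = (2 : ℝ) ^ n := ⟨_, rfl⟩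
  rw [← hE] at hL
  have hE0 : (0 : ℝ) ≤ E := by rw [hE]; positivity
  have hnE : (n : ℝ) + 1 ≤ E := by
    have h1 : n + 1 ≤ 2 ^ n := Nat.succ_le_of_lt (@Nat.lt_two_pow_self n)
    have h2 : ((n + 1 : ℕ) : ℝ) ≤ ((2 ^ n : ℕ) : ℝ) := by exact_mod_cast h1
    push_cast at h2
    rw [hE]; exact h2
  -- `G·X·L ≤ 32(n+1) · 2^27 (n+1) W⁺ · 2^63 E^43 p Ω ≤ 2^95 E^45 p Ω W⁺`
  have hXL : (P.X : ℝ) * P.L ≤ ((2 : ℝ) ^ 27 * ((n : ℝ) + 1) * P.Wp) * ((2 : ℝ) ^ 63 * E ^ 43 * P.p * P.Ω) :=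
    mul_le_mul hX hL hL0 (by positivity)
  have hGXL : P.G * P.X * P.L ≤ (32 * ((n : ℝ) + 1)) * (((2 : ℝ) ^ 27 * ((n : ℝ) + 1) * P.Wp) *
      ((2 : ℝ) ^ 63 * E ^ 43 * P.p * P.Ω)) := by
    rw [mul_assoc]
    exact mul_le_mul hG hXL (by positivity) (by positivity)
  have hn2 : ((n : ℝ) + 1) * ((n : ℝ) + 1) ≤ E * E :=
    mul_le_mul hnE hnE (by positivity) hE0
  have hrest : 0 ≤ E ^ 43 * P.p * P.Ω * P.Wp := by positivity
  have hmain : 2 * (8 * E * (P.G * P.X * P.L)) ≤ (2 : ℝ) ^ 99 * E ^ 46 * P.p * P.Ω * P.Wp := by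
    calc 2 * (8 * E * (P.G * P.X * P.L))
        ≤ 2 * (8 * E * ((32 * ((n : ℝ) + 1)) * (((2 : ℝ) ^ 27 * ((n : ℝ) + 1) * P.Wp) *
            ((2 : ℝ) ^ 63 * E ^ 43 * P.p * P.Ω)))) := by
          have h8E : 0 ≤ 8 * E := by positivity
          linarith [mul_le_mul_of_nonneg_left hGXL h8E]
      _ = (2 : ℝ) ^ 99 * E * (((n : ℝ) + 1) * ((n : ℝ) + 1)) * (E ^ 43 * P.p * P.Ω * P.Wp) := by ring
      _ ≤ (2 : ℝ) ^ 99 * E * (E * E) * (E ^ 43 * P.p * P.Ω * P.Wp) := by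
          have h1 : 0 ≤ (2 : ℝ) ^ 99 * E := mul_nonneg (pow_nonneg (by norm_num) 99) hE0
          exact mul_le_mul_of_nonneg_right (mul_le_mul_of_nonneg_left hn2 h1) hrest
      _ = (2 : ℝ) ^ 99 * E ^ 46 * P.p * P.Ω * P.Wp := by ring
  -- `2^99 E^46 = 2^{46n+99} ≤ 2^{100n}` for `n ≥ 2`
  have hpow : (2 : ℝ) ^ 99 * E ^ 46 ≤ (2 : ℝ) ^ (100 * n) := by
    rw [hE, ← pow_mul, ← pow_add]
    exact pow_le_pow_right₀ (by norm_num) (by omega)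
  have hfin : (2 : ℝ) ^ 99 * E ^ 46 * P.p * P.Ω * P.Wp ≤ (2 : ℝ) ^ (100 * n) * P.p * P.Ω * P.Wp := by
    have h0 : 0 ≤ (P.p : ℝ) * P.Ω * P.Wp := by positivity
    calc (2 : ℝ) ^ 99 * E ^ 46 * P.p * P.Ω * P.Wp = ((2 : ℝ) ^ 99 * E ^ 46) * (P.p * P.Ω * P.Wp) := by ring
      _ ≤ (2 : ℝ) ^ (100 * n) * (P.p * P.Ω * P.Wp) := mul_le_mul_of_nonneg_right hpow h0
      _ = (2 : ℝ) ^ (100 * n) * P.p * P.Ω * P.Wp := by ring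
  rw [hE] at hmain
  exact hmain.trans (hE ▸ hfin)

/-- The same headline in the `(p/log p)` currency of the frame's negated bound:
`2·(8·2ⁿ·(G·X·L)) ≤ 2^{100·n}·(p/log p)·Ω·W⁺` (`log p < 16(n+1) ≤ 2^{n+3}` at `m ≥ 1`). [cite: Yu2007, Main Thm (K = ℚ); shape only] -/
theorem headline_odd1_div_log (hn : 2 ≤ n) (hm : 1 ≤ P.m) (hθ : P.θ₀ = 1 / 2) (hNq : P.Nq = P.K)
    (hAmax : P.Amax ≤ 2 ^ n * P.Ω) (hA1 : ∀ j, 1 ≤ P.A j) :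
    2 * (8 * 2 ^ n * (P.G * P.X * P.L)) ≤ (2 : ℝ) ^ (100 * n) * ((P.p : ℝ) / Real.log P.p) * P.Ω * P.Wp := by
  have hNqK : P.Nq ≤ 2 ^ n * P.K := by rw [hNq]; exact Nat.le_mul_of_pos_left _ (Nat.two_pow_pos n)
  have hG := P.G_le_of_m_pos hm hθ
  have hL := P.L_le_of_m_pos hm hθ hNqK hAmax hA1
  have hX := P.X_le_of_m_pos hm hθ hNqK hAmax hA1
  have hlogp := P.log_p_lt_of_m_pos hm hθ
  have hlog0 := P.log_p_pos
  have hΩ := P.Ω_pos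
  have hWp := P.one_le_Wp
  have hp0 : (0 : ℝ) < P.p := by linarith [P.two_le_p]
  have hG0 : (0 : ℝ) ≤ P.G := by linarith [P.eight_le_G]
  have hX0 : (0 : ℝ) ≤ P.X := by positivity
  have hL0 : (0 : ℝ) ≤ P.L := by positivity
  obtain ⟨E, hE⟩ : ∃ E : ℝ, E = (2 : ℝ) ^ n := ⟨_, rfl⟩
  rw [← hE] at hL
  have hE0 : (0 : ℝ) ≤ E := by rw [hE]; positivity
  have hnE : (n : ℝ) + 1 ≤ E := by
    have h1 : n + 1 ≤ 2 ^ n := Nat.succ_le_of_lt (@Nat.lt_two_pow_self n)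
    have h2 : ((n + 1 : ℕ) : ℝ) ≤ ((2 ^ n : ℕ) : ℝ) := by exact_mod_cast h1
    push_cast at h2
    rw [hE]; exact h2
  -- `p = (p/log p)·log p ≤ (p/log p)·16(n+1) ≤ (p/log p)·16 E`
  obtain ⟨q, hq⟩ : ∃ q : ℝ, q = (P.p : ℝ) / Real.log P.p := ⟨_, rfl⟩
  have hq0 : 0 ≤ q := by rw [hq]; exact div_nonneg hp0.le hlog0.le
  have hpq : (P.p : ℝ) ≤ q * (16 * E) := by
    have e : (P.p : ℝ) = q * Real.log P.p := by rw [hq]; field_simp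
    rw [e]
    apply mul_le_mul_of_nonneg_left _ hq0
    linarith
  have hXL : (P.X : ℝ) * P.L ≤ ((2 : ℝ) ^ 27 * ((n : ℝ) + 1) * P.Wp) * ((2 : ℝ) ^ 63 * E ^ 43 * P.p * P.Ω) :=
    mul_le_mul hX hL hL0 (by positivity)
  have hGXL : P.G * P.X * P.L ≤ (32 * ((n : ℝ) + 1)) * (((2 : ℝ) ^ 27 * ((n : ℝ) + 1) * P.Wp) *
      ((2 : ℝ) ^ 63 * E ^ 43 * P.p * P.Ω)) := by
    rw [mul_assoc]
    exact mul_le_mul hG hXL (by positivity) (by positivity)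
  have hn2 : ((n : ℝ) + 1) * ((n : ℝ) + 1) ≤ E * E :=
    mul_le_mul hnE hnE (by positivity) hE0
  have hmain : 2 * (8 * E * (P.G * P.X * P.L)) ≤ (2 : ℝ) ^ 103 * E ^ 47 * q * P.Ω * P.Wp := by
    have hrest : 0 ≤ E ^ 43 * P.Ω * P.Wp := by positivity
    calc 2 * (8 * E * (P.G * P.X * P.L))
        ≤ 2 * (8 * E * ((32 * ((n : ℝ) + 1)) * (((2 : ℝ) ^ 27 * ((n : ℝ) + 1) * P.Wp) *
            ((2 : ℝ) ^ 63 * E ^ 43 * P.p * P.Ω)))) := by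
          have h8E : 0 ≤ 8 * E := by positivity
          linarith [mul_le_mul_of_nonneg_left hGXL h8E]
      _ = (2 : ℝ) ^ 99 * E * (((n : ℝ) + 1) * ((n : ℝ) + 1)) * P.p * (E ^ 43 * P.Ω * P.Wp) := by ring
      _ ≤ (2 : ℝ) ^ 99 * E * (E * E) * (q * (16 * E)) * (E ^ 43 * P.Ω * P.Wp) := by
          have h1 : 0 ≤ (2 : ℝ) ^ 99 * E := mul_nonneg (pow_nonneg (by norm_num) 99) hE0
          have h2 : (2 : ℝ) ^ 99 * E * (((n : ℝ) + 1) * ((n : ℝ) + 1)) ≤ (2 : ℝ) ^ 99 * E * (E * E) :=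
            mul_le_mul_of_nonneg_left hn2 h1
          have h3 := mul_le_mul h2 hpq hp0.le (mul_nonneg h1 (mul_nonneg hE0 hE0))
          exact mul_le_mul_of_nonneg_right h3 hrest
      _ = (2 : ℝ) ^ 103 * E ^ 47 * q * P.Ω * P.Wp := by ring
  have hpow : (2 : ℝ) ^ 103 * E ^ 47 ≤ (2 : ℝ) ^ (100 * n) := by
    rw [hE, ← pow_mul, ← pow_add]
    exact pow_le_pow_right₀ (by norm_num) (by omega)
  have hfin : (2 : ℝ) ^ 103 * E ^ 47 * q * P.Ω * P.Wp ≤ (2 : ℝ) ^ (100 * n) * q * P.Ω * P.Wp := by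
    have h0 : 0 ≤ q * P.Ω * P.Wp := by positivity
    calc (2 : ℝ) ^ 103 * E ^ 47 * q * P.Ω * P.Wp = ((2 : ℝ) ^ 103 * E ^ 47) * (q * P.Ω * P.Wp) := by ring
      _ ≤ (2 : ℝ) ^ (100 * n) * (q * P.Ω * P.Wp) := mul_le_mul_of_nonneg_right hpow h0
      _ = (2 : ℝ) ^ (100 * n) * q * P.Ω * P.Wp := by ring
  rw [hE] at hmain
  rw [← hq]
  exact hmain.trans (hE ▸ hfin)

/-- The headline in the crux skeleton's LITERAL constant shape `((2:ℝ)^100)^n` (cell constant `cY07 = 2^100`,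
planner g9 2026-08-27T05:11:13Z). [cite: Yu2007, Main Thm (K = ℚ); shape only] -/
theorem headline_odd1_lit (hn : 2 ≤ n) (hm : 1 ≤ P.m) (hθ : P.θ₀ = 1 / 2) (hNq : P.Nq = P.K)
    (hAmax : P.Amax ≤ 2 ^ n * P.Ω) (hA1 : ∀ j, 1 ≤ P.A j) :
    2 * (8 * 2 ^ n * (P.G * P.X * P.L)) ≤ ((2 : ℝ) ^ 100) ^ n * P.p * P.Ω * P.Wp := by
  rw [← pow_mul]
  exact P.headline_odd1 hn hm hθ hNq hAmax hA1

/-- The `(p/log p)` headline in the literal constant shape `((2:ℝ)^100)^n`. [cite: Yu2007, Main Thm (K = ℚ); shape only] -/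
theorem headline_odd1_div_log_lit (hn : 2 ≤ n) (hm : 1 ≤ P.m) (hθ : P.θ₀ = 1 / 2) (hNq : P.Nq = P.K)
    (hAmax : P.Amax ≤ 2 ^ n * P.Ω) (hA1 : ∀ j, 1 ≤ P.A j) :
    2 * (8 * 2 ^ n * (P.G * P.X * P.L)) ≤ ((2 : ℝ) ^ 100) ^ n * ((P.p : ℝ) / Real.log P.p) * P.Ω * P.Wp := by
  rw [← pow_mul]
  exact P.headline_odd1_div_log hn hm hθ hNq hAmax hA1

end PadicG3Par

end Summit.ABC.StewartYu

end
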